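import Summits.Langlands.Langlands.Theses.TwistAveragedDeinduction

/-!
# Birth skeleton — piece `AutomorphicDeinduction` of the decomposition of `AJunction`
(route TwistAveragedDeinduction, parent crux stmt-Langlands-16013; strategist planner-cstrat-stmt-Langlands-16013-r1-0)

Three registered stubs and the kernel-checked composition `AutomorphicDeinduction_of`:
`stub_weakBaseChangeToF` (the HARDEST: weak base change ℚ → F of L-algebraic automorphic
representations of `GL_N`, for an ARBITRARY number field `F` — insoluble Galois closure allowed;
Arthur–Clozel give the solvable case), `stub_mackeyComplement` (Mackey: `Res_(Γ_F) Ind ρ = ρ ⊕ ρ′`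
with a typed complement `ρ′` whose Frobenius polynomials complete those of `ρ` to the
Galois-dictionary Satake polynomials of the base change), `stub_cuspidalConstituent` (given (A) a.e.:
an irreducible `ρ` which, together with some `ρ′`, matches an L-algebraic automorphic `PF` a.e. is
weakly CUSPIDAL automorphic — cuspidal support + Chebotarev–Brauer–Nesbitt + Jordan–Hölder).
Sorries ONLY inside `stub_*`.
-/

namespace Summit.Langlands.Langlands.Cruxes.AJunction.BirthAutomorphicDeinduction

open scoped BigOperators Topology Manifold Classical MeasureTheory ProbabilityTheory Matrix InnerProductSpace ComplexConjugate ContinuousMap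
open Filter Set Function TopologicalSpace MeasureTheory
open Summit.Langlands.Langlands.Theses.TwistAveragedDeinduction

/-- The piece, verbatim (child `AutomorphicDeinduction` of `AJunction`; not yet a route decl). -/
def AutomorphicDeinduction : Prop :=
  AutToGalAllFieldsAE → ∀ (F : Type) [Field F] [NumberField F] (n : ℕ), 0 < n → ∀ (hF : Literature.NumberTheory.Automorphic.isCompact_glFiniteIntegralLevel n F) (ℓ : ℕ) [Fact ℓ.Prime] (ι : PadicAlgCl ℓ ≃+* ℂ) (ρ : Literature.NumberTheory.GaloisRepresentations.FramedGaloisRep F (PadicAlgCl ℓ) n), ρ.toGaloisRep.IsIrreducible → (∀ᶠ w : IsDedekindDomain.HeightOneSpectrum (NumberField.RingOfIntegers F) in cofinite, ρ.IsUnramifiedAt w) → (∀ (w : IsDedekindDomain.HeightOneSpectrum (NumberField.RingOfIntegers F)) (hw : ((ℓ : ℕ) : NumberField.RingOfIntegers F) ∈ w.asIdeal), (Literature.NumberTheory.PAdicHodge.fontainePstAdicCompletion w ℓ hw).IsDeRhamFramed (ρ.toLocal w)) → ∀ (hQ : Literature.NumberTheory.Automorphic.isCompact_glFiniteIntegralLevel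 (n * Module.finrank ℚ F) ℚ) (P : Literature.NumberTheory.Automorphic.AutomorphicRepData (Literature.NumberTheory.Automorphic.AutomorphyDatum.gl (n * Module.finrank ℚ F) ℚ hQ)), P.IsLAlgebraic → (∀ᶠ v : IsDedekindDomain.HeightOneSpectrum (NumberField.RingOfIntegers ℚ) in cofinite, ∀ β : IsDedekindDomain.HeightOneSpectrum (NumberField.RingOfIntegers F) → Multiset ℂ, (∀ w : IsDedekindDomain.HeightOneSpectrum (NumberField.RingOfIntegers F), w.asIdeal.under (NumberField.RingOfIntegers ℚ) = v.asIdeal → ρ.IsUnramifiedAt w ∧ ρ.HasFrobCharpolyAt w (Literature.NumberTheory.Automorphic.arithFrobPolyOfSatake ι w.residueCard 1 (β w))) → ∃ α : Multiset ℂ, P.HasSatakeParamAt v α ∧ Literature.NumberTheory.Automorphic.satakePolynomial α = ∏ᶠ w ∈ {w : IsDedekindDomain.HeightOneSpectrum (NumberField.RingOfIntegers F) | w.asIdeal.under (NumberField.RingOfIntegers ℚ) = v.asIdeal}, (Literature.NumberTheory.Automorphic.satakePolynomial (β w)).comp (Polynomial.X ^ w.asIdeal.inertiaDeg (NumberField.RingOfIntegers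 ℚ))) → ∃ π : Literature.NumberTheory.Automorphic.CuspidalAutomorphicRepData n F hF, π.1.IsLAlgebraic ∧ ∀ᶠ w : IsDedekindDomain.HeightOneSpectrum (NumberField.RingOfIntegers F) in cofinite, Summit.Langlands.SatakeFrobCompatibleAt ι π.1 ρ w

/-- **stub_weakBaseChangeToF** (XL/open for insoluble Galois closures; SolvableImageBarrier):
every L-algebraic automorphic representation `P` of `GL_N(𝔸_ℚ)` has, over every number field `F`,
an L-algebraic automorphic `PF` of `GL_N(𝔸_F)` weakly base-changed from it: at almost every
finite place `w` of `F` over `p`, the Satake parameter of `PF` is the `f(w∣p)`-th power of that of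
`P` at `p`. [cite: ArthurClozelAMS120, Ch. 3 Thm. 4.2 and Thm. 5.1] [cite: Getz2012Nonsolvable, §1] -/
theorem stub_weakBaseChangeToF : ∀ (N : ℕ), 0 < N → ∀ (hQ : Literature.NumberTheory.Automorphic.isCompact_glFiniteIntegralLevel N ℚ) (P : Literature.NumberTheory.Automorphic.AutomorphicRepData (Literature.NumberTheory.Automorphic.AutomorphyDatum.gl N ℚ hQ)), P.IsLAlgebraic → ∀ (F : Type) [Field F] [NumberField F], ∃ (hF' : Literature.NumberTheory.Automorphic.isCompact_glFiniteIntegralLevel N F) (PF : Literature.NumberTheory.Automorphic.AutomorphicRepData (Literature.NumberTheory.Automorphic.AutomorphyDatum.gl N F hF')), PF.IsLAlgebraic ∧ ∀ᶠ w : IsDedekindDomain.HeightOneSpectrum (NumberField.RingOfIntegers F) in cofinite, ∀ (v : IsDedekindDomain.HeightOneSpectrum (NumberField.RingOfIntegers ℚ)) (α : Multiset ℂ), w.asIdeal.under (NumberField.RingOfIntegers ℚ) = v.asIdeal → P.HasSatakeParamAt v α → PF.HasSatakeParamAt w (α.map fun a => a ^ w.asIdeal.inertiaDeg (NumberField.RingOfIntegers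 ℚ)) := by
  sorry

/-- **stub_mackeyComplement** (L; tree `FramedGaloisRep.induce`, `exists_charpoly_induce_eq_prod`,
`induce_restrictField_apply_coe`): if `P` carries the Satake data of `Ind ρ` and `PF` is a weak
base change of `P` to `F`, there is `ρ′ : Γ_F → GL_(n[F:ℚ]−n)` (the Mackey complement
`⊕_(g ∉ Γ_F) Ind (ρ^g)|`), unramified a.e., with `charpoly ρ(Frob_w) · charpoly ρ′(Frob_w)` equal to
the Galois-dictionary Satake polynomial of `PF` at almost every `w`. [cite: SerreAbelianLadic1968, Ch. I §2.3] -/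
theorem stub_mackeyComplement : ∀ (F : Type) [Field F] [NumberField F] (n : ℕ), 0 < n → ∀ (ℓ : ℕ) [Fact ℓ.Prime] (ι : PadicAlgCl ℓ ≃+* ℂ) (ρ : Literature.NumberTheory.GaloisRepresentations.FramedGaloisRep F (PadicAlgCl ℓ) n), (∀ᶠ w : IsDedekindDomain.HeightOneSpectrum (NumberField.RingOfIntegers F) in cofinite, ρ.IsUnramifiedAt w) → ∀ (hQ : Literature.NumberTheory.Automorphic.isCompact_glFiniteIntegralLevel (n * Module.finrank ℚ F) ℚ) (P : Literature.NumberTheory.Automorphic.AutomorphicRepData (Literature.NumberTheory.Automorphic.AutomorphyDatum.gl (n * Module.finrank ℚ F) ℚ hQ)), (∀ᶠ v : IsDedekindDomain.HeightOneSpectrum (NumberField.RingOfIntegers ℚ) in cofinite, ∀ β : IsDedekindDomain.HeightOneSpectrum (NumberField.RingOfIntegers F) → Multiset ℂ, (∀ w : IsDedekindDomain.HeightOneSpectrum (NumberField.RingOfIntegers F), w.asIdeal.under (NumberField.RingOfIntegers ℚ) = v.asIdeal → ρ.IsUnramifiedAt w ∧ ρ.HasFrobCharpolyAt w (Literature.NumberTheory.Automorphic.arithFrobPolyOfSatake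 ι w.residueCard 1 (β w))) → ∃ α : Multiset ℂ, P.HasSatakeParamAt v α ∧ Literature.NumberTheory.Automorphic.satakePolynomial α = ∏ᶠ w ∈ {w : IsDedekindDomain.HeightOneSpectrum (NumberField.RingOfIntegers F) | w.asIdeal.under (NumberField.RingOfIntegers ℚ) = v.asIdeal}, (Literature.NumberTheory.Automorphic.satakePolynomial (β w)).comp (Polynomial.X ^ w.asIdeal.inertiaDeg (NumberField.RingOfIntegers ℚ))) → ∀ (hF' : Literature.NumberTheory.Automorphic.isCompact_glFiniteIntegralLevel (n * Module.finrank ℚ F) F) (PF : Literature.NumberTheory.Automorphic.AutomorphicRepData (Literature.NumberTheory.Automorphic.AutomorphyDatum.gl (n * Module.finrank ℚ F) F hF')), (∀ᶠ w : IsDedekindDomain.HeightOneSpectrum (NumberField.RingOfIntegers F) in cofinite, ∀ (v : IsDedekindDomain.HeightOneSpectrum (NumberField.RingOfIntegers ℚ)) (α : Multiset ℂ), w.asIdeal.under (NumberField.RingOfIntegers ℚ) = v.asIdeal → P.HasSatakeParamAt v α → PF.HasSatakeParamAt w (α.map fun a => a ^ w.asIdeal.inertiaDeg (NumberField.RingOfIntegers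 ℚ))) → ∃ ρ' : Literature.NumberTheory.GaloisRepresentations.FramedGaloisRep F (PadicAlgCl ℓ) (n * Module.finrank ℚ F - n), (∀ᶠ w : IsDedekindDomain.HeightOneSpectrum (NumberField.RingOfIntegers F) in cofinite, ρ'.IsUnramifiedAt w) ∧ ∀ᶠ w : IsDedekindDomain.HeightOneSpectrum (NumberField.RingOfIntegers F) in cofinite, ∀ (Q Q' : Polynomial (PadicAlgCl ℓ)), ρ.IsUnramifiedAt w → ρ.HasFrobCharpolyAt w Q → ρ'.IsUnramifiedAt w → ρ'.HasFrobCharpolyAt w Q' → ∃ γ : Multiset ℂ, PF.HasSatakeParamAt w γ ∧ Literature.NumberTheory.Automorphic.arithFrobPolyOfSatake ι w.residueCard 1 γ = Q * Q' := by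
  sorry

/-- **stub_cuspidalConstituent** (L, consumes (A) a.e.): an IRREDUCIBLE `ρ` which together with
some `ρ′` matches an L-algebraic automorphic `PF` of `GL_N(𝔸_F)` at almost every place is weakly
cuspidal automorphic on `GL_n(𝔸_F)`: cuspidal support `PF ~ ⊞ π_i′` with L-algebraic cuspidal
`π_i′` (Langlands 1979 Prop. 2, Jacquet–Shalika), Galois avatars `r_i` by (A)_ae,
`(ρ ⊕ ρ′)^ss ≅ ⊕ r_i` by Chebotarev + Brauer–Nesbitt, `ρ ≅ r_i` for some `i` by Jordan–Hölder.
[cite: LanglandsCorvallis1979Notion, Prop. 2] [cite: JacquetShalikaAJM1981II, Thm. 4.4] [cite: DeligneSerreASENS1974, Lemme 3.2] -/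
theorem stub_cuspidalConstituent : AutToGalAllFieldsAE → ∀ (F : Type) [Field F] [NumberField F] (n : ℕ), 0 < n → ∀ (hF : Literature.NumberTheory.Automorphic.isCompact_glFiniteIntegralLevel n F) (ℓ : ℕ) [Fact ℓ.Prime] (ι : PadicAlgCl ℓ ≃+* ℂ) (ρ : Literature.NumberTheory.GaloisRepresentations.FramedGaloisRep F (PadicAlgCl ℓ) n), ρ.toGaloisRep.IsIrreducible → (∀ᶠ w : IsDedekindDomain.HeightOneSpectrum (NumberField.RingOfIntegers F) in cofinite, ρ.IsUnramifiedAt w) → ∀ (m : ℕ) (ρ' : Literature.NumberTheory.GaloisRepresentations.FramedGaloisRep F (PadicAlgCl ℓ) m), (∀ᶠ w : IsDedekindDomain.HeightOneSpectrum (NumberField.RingOfIntegers F) in cofinite, ρ'.IsUnramifiedAt w) → ∀ (N : ℕ) (hF' : Literature.NumberTheory.Automorphic.isCompact_glFiniteIntegralLevel N F) (PF : Literature.NumberTheory.Automorphic.AutomorphicRepData (Literature.NumberTheory.Automorphic.AutomorphyDatum.gl N F hF')), PF.IsLAlgebraic → (∀ᶠ w : IsDedekindDomain.HeightOneSpectrum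 (NumberField.RingOfIntegers F) in cofinite, ∀ (Q Q' : Polynomial (PadicAlgCl ℓ)), ρ.IsUnramifiedAt w → ρ.HasFrobCharpolyAt w Q → ρ'.IsUnramifiedAt w → ρ'.HasFrobCharpolyAt w Q' → ∃ γ : Multiset ℂ, PF.HasSatakeParamAt w γ ∧ Literature.NumberTheory.Automorphic.arithFrobPolyOfSatake ι w.residueCard 1 γ = Q * Q') → ∃ π : Literature.NumberTheory.Automorphic.CuspidalAutomorphicRepData n F hF, π.1.IsLAlgebraic ∧ ∀ᶠ w : IsDedekindDomain.HeightOneSpectrum (NumberField.RingOfIntegers F) in cofinite, Summit.Langlands.SatakeFrobCompatibleAt ι π.1 ρ w := by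
  sorry

/-- **Composition**: the three stubs give the piece. [folklore] -/
theorem AutomorphicDeinduction_of : (∀ (N : ℕ), 0 < N → ∀ (hQ : Literature.NumberTheory.Automorphic.isCompact_glFiniteIntegralLevel N ℚ) (P : Literature.NumberTheory.Automorphic.AutomorphicRepData (Literature.NumberTheory.Automorphic.AutomorphyDatum.gl N ℚ hQ)), P.IsLAlgebraic → ∀ (F : Type) [Field F] [NumberField F], ∃ (hF' : Literature.NumberTheory.Automorphic.isCompact_glFiniteIntegralLevel N F) (PF : Literature.NumberTheory.Automorphic.AutomorphicRepData (Literature.NumberTheory.Automorphic.AutomorphyDatum.gl N F hF')), PF.IsLAlgebraic ∧ ∀ᶠ w : IsDedekindDomain.HeightOneSpectrum (NumberField.RingOfIntegers F) in cofinite, ∀ (v : IsDedekindDomain.HeightOneSpectrum (NumberField.RingOfIntegers ℚ)) (α : Multiset ℂ), w.asIdeal.under (NumberField.RingOfIntegers ℚ) = v.asIdeal → P.HasSatakeParamAt v α → PF.HasSatakeParamAt w (α.map fun a => a ^ w.asIdeal.inertiaDeg (NumberField.RingOfIntegers ℚ))) → (∀ (F : Type) [Field F] [NumberField F] (n : ℕ),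 0 < n → ∀ (ℓ : ℕ) [Fact ℓ.Prime] (ι : PadicAlgCl ℓ ≃+* ℂ) (ρ : Literature.NumberTheory.GaloisRepresentations.FramedGaloisRep F (PadicAlgCl ℓ) n), (∀ᶠ w : IsDedekindDomain.HeightOneSpectrum (NumberField.RingOfIntegers F) in cofinite, ρ.IsUnramifiedAt w) → ∀ (hQ : Literature.NumberTheory.Automorphic.isCompact_glFiniteIntegralLevel (n * Module.finrank ℚ F) ℚ) (P : Literature.NumberTheory.Automorphic.AutomorphicRepData (Literature.NumberTheory.Automorphic.AutomorphyDatum.gl (n * Module.finrank ℚ F) ℚ hQ)), (∀ᶠ v : IsDedekindDomain.HeightOneSpectrum (NumberField.RingOfIntegers ℚ) in cofinite, ∀ β : IsDedekindDomain.HeightOneSpectrum (NumberField.RingOfIntegers F) → Multiset ℂ, (∀ w : IsDedekindDomain.HeightOneSpectrum (NumberField.RingOfIntegers F), w.asIdeal.under (NumberField.RingOfIntegers ℚ) = v.asIdeal → ρ.IsUnramifiedAt w ∧ ρ.HasFrobCharpolyAt w (Literature.NumberTheory.Automorphic.arithFrobPolyOfSatake ι w.residueCard 1 (β w))) → ∃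 α : Multiset ℂ, P.HasSatakeParamAt v α ∧ Literature.NumberTheory.Automorphic.satakePolynomial α = ∏ᶠ w ∈ {w : IsDedekindDomain.HeightOneSpectrum (NumberField.RingOfIntegers F) | w.asIdeal.under (NumberField.RingOfIntegers ℚ) = v.asIdeal}, (Literature.NumberTheory.Automorphic.satakePolynomial (β w)).comp (Polynomial.X ^ w.asIdeal.inertiaDeg (NumberField.RingOfIntegers ℚ))) → ∀ (hF' : Literature.NumberTheory.Automorphic.isCompact_glFiniteIntegralLevel (n * Module.finrank ℚ F) F) (PF : Literature.NumberTheory.Automorphic.AutomorphicRepData (Literature.NumberTheory.Automorphic.AutomorphyDatum.gl (n * Module.finrank ℚ F) F hF')), (∀ᶠ w : IsDedekindDomain.HeightOneSpectrum (NumberField.RingOfIntegers F) in cofinite, ∀ (v : IsDedekindDomain.HeightOneSpectrum (NumberField.RingOfIntegers ℚ)) (α : Multiset ℂ), w.asIdeal.under (NumberField.RingOfIntegers ℚ) = v.asIdeal → P.HasSatakeParamAt v α → PF.HasSatakeParamAt w (α.map fun a => a ^ w.asIdeal.inertiaDeg (NumberField.RingOfIntegers ℚ))) → ∃ ρ' :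 Literature.NumberTheory.GaloisRepresentations.FramedGaloisRep F (PadicAlgCl ℓ) (n * Module.finrank ℚ F - n), (∀ᶠ w : IsDedekindDomain.HeightOneSpectrum (NumberField.RingOfIntegers F) in cofinite, ρ'.IsUnramifiedAt w) ∧ ∀ᶠ w : IsDedekindDomain.HeightOneSpectrum (NumberField.RingOfIntegers F) in cofinite, ∀ (Q Q' : Polynomial (PadicAlgCl ℓ)), ρ.IsUnramifiedAt w → ρ.HasFrobCharpolyAt w Q → ρ'.IsUnramifiedAt w → ρ'.HasFrobCharpolyAt w Q' → ∃ γ : Multiset ℂ, PF.HasSatakeParamAt w γ ∧ Literature.NumberTheory.Automorphic.arithFrobPolyOfSatake ι w.residueCard 1 γ = Q * Q') → (AutToGalAllFieldsAE → ∀ (F : Type) [Field F] [NumberField F] (n : ℕ), 0 < n → ∀ (hF : Literature.NumberTheory.Automorphic.isCompact_glFiniteIntegralLevel n F) (ℓ : ℕ) [Fact ℓ.Prime] (ι : PadicAlgCl ℓ ≃+* ℂ) (ρ : Literature.NumberTheory.GaloisRepresentations.FramedGaloisRep F (PadicAlgCl ℓ) n), ρ.toGaloisRep.IsIrreducible → (∀ᶠ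 w : IsDedekindDomain.HeightOneSpectrum (NumberField.RingOfIntegers F) in cofinite, ρ.IsUnramifiedAt w) → ∀ (m : ℕ) (ρ' : Literature.NumberTheory.GaloisRepresentations.FramedGaloisRep F (PadicAlgCl ℓ) m), (∀ᶠ w : IsDedekindDomain.HeightOneSpectrum (NumberField.RingOfIntegers F) in cofinite, ρ'.IsUnramifiedAt w) → ∀ (N : ℕ) (hF' : Literature.NumberTheory.Automorphic.isCompact_glFiniteIntegralLevel N F) (PF : Literature.NumberTheory.Automorphic.AutomorphicRepData (Literature.NumberTheory.Automorphic.AutomorphyDatum.gl N F hF')), PF.IsLAlgebraic → (∀ᶠ w : IsDedekindDomain.HeightOneSpectrum (NumberField.RingOfIntegers F) in cofinite, ∀ (Q Q' : Polynomial (PadicAlgCl ℓ)), ρ.IsUnramifiedAt w → ρ.HasFrobCharpolyAt w Q → ρ'.IsUnramifiedAt w → ρ'.HasFrobCharpolyAt w Q' → ∃ γ : Multiset ℂ, PF.HasSatakeParamAt w γ ∧ Literature.NumberTheory.Automorphic.arithFrobPolyOfSatake ι w.residueCard 1 γ = Q * Q') → ∃ π : Literature.NumberTheory.Automorphic.CuspidalAutomorphicRepData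 n F hF, π.1.IsLAlgebraic ∧ ∀ᶠ w : IsDedekindDomain.HeightOneSpectrum (NumberField.RingOfIntegers F) in cofinite, Summit.Langlands.SatakeFrobCompatibleAt ι π.1 ρ w) → AutomorphicDeinduction := by
  intro h1 h2 h3 hA F _ _ n hn hF ℓ _ ι ρ hirr hunr hdR hQ P hPalg hind
  have hN : 0 < n * Module.finrank ℚ F := Nat.mul_pos hn Module.finrank_pos
  obtain ⟨hF', PF, hPFalg, hbc⟩ := h1 (n * Module.finrank ℚ F) hN hQ P hPalg F
  obtain ⟨ρ', hunr', hmatch⟩ := h2 F n hn ℓ ι ρ hunr hQ P hind hF' PF hbc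
  exact h3 hA F n hn hF ℓ ι ρ hirr hunr (n * Module.finrank ℚ F - n) ρ' hunr' (n * Module.finrank ℚ F) hF' PF hPFalg hmatch

end Summit.Langlands.Langlands.Cruxes.AJunction.BirthAutomorphicDeinduction
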